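import Mathlib
import Summits.SmoothPoincare4.SmoothPoincare4.Theorems.CylinderEntropyCylinderRungTwoKCertDefsFast
import Summits.SmoothPoincare4.SmoothPoincare4.Theorems.CylinderEntropyCylinderRungTwoKCertSoundArith
import Summits.SmoothPoincare4.SmoothPoincare4.Theorems.CylinderEntropySliceIsolationCertEnvelope
import HarnessLib

/-!
# Kernel certificate checker for `stub_certMid`, V: calculus of the pulled-back kernel

Infrastructure file 5 for the kernel-clean discharge of the registered stub `stub_certMid` of crux
stmt-SmoothPoincare4-7631 (`Summit.SmoothPoincare4.SmoothPoincare4.Theses.CylinderEntropy.CylinderRungTwo`, line `killing-flux`).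
The pulled-back Euclidean kernel in the angle coordinate,
`Ek T u θ = (6T²)⁻¹ e^{4u} e^{-Q/(4T)}`, `Q = e^{2u} - 2 e^u cos θ + 1` (`= pulledR T u (cos θ)`), and the real-analysis facts the
leaf test of the checker relies on:

* `Ek_upper` — the certified UPPER bound over `e^u ∈ [xlo, xhi]`, `cos θ ≤ chi`, uniformly in `T ∈ [T₁, T₂]` (exact `T`-envelope,
  `helper_certTsup`; this is both the corner bound `eCorner` and the box bound `EhiB`);
* `Ek_lower` — the certified LOWER bound over a box for `T` in the envelope range `[Ta, Tb]` (unimodality of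
  `T ↦ T⁻² e^{-Q/(4T)}`: the minimum over an interval is at an end point, `phi_ge_min`);
* `Ek_mono_T_of_le`, `Ek_mono_T_of_ge` — outside the envelope range the kernel is dominated by its value at the nearer end
  (reduction of `T ∈ [T₁, T₂]` to `T ∈ [Ta, Tb]`);
* `hasDerivAt_Ek_u`, `hasDerivAt_Ek_θ` — the two partial derivatives;
* `ksqrtF_spec`, `sin_memF` — the validated square roots and the sine enclosure from a cosine enclosure.
No named facts.
-/

-- the registered namespace `Summit.SmoothPoincare4.SmoothPoincare4.…` repeats a component
set_option linter.dupNamespace false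

noncomputable section
namespace Summit.SmoothPoincare4.SmoothPoincare4.Cruxes.CylinderRungTwo.KillingFlux

namespace KCert

open Set Summit.SmoothPoincare4.SmoothPoincare4.Theorems.CylinderEntropySliceIsolation
open Summit.SmoothPoincare4.SmoothPoincare4.Theorems.CylinderEntropySliceIsolation.Cert

/-! ### The kernel in the angle coordinate -/

/-- `Q(u, θ) = e^{2u} - 2e^u cos θ + 1 = |e^u ω - e₁|²`. [folklore] -/
def Qk (u θ : ℝ) : ℝ := Real.exp (2 * u) - 2 * Real.exp u * Real.cos θ + 1

/-- The pulled-back kernel `(6T²)⁻¹ e^{4u} e^{-Q/(4T)}`. [folklore] -/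
def Ek (T u θ : ℝ) : ℝ := (6 * T ^ 2)⁻¹ * Real.exp (4 * u) * Real.exp (-Qk u θ / (4 * T))

/-- `Ek` is the tree's `pulledR` at `s = cos θ`. [folklore] -/
theorem pulledR_cos (T u θ : ℝ) (hT : T ≠ 0) : Cert.pulledR T u (Real.cos θ) = Ek T u θ := by
  unfold Cert.pulledR Ek Qk
  rw [Cert.pulled_prefactor T hT]

/-- `0 < Ek`. [folklore] -/
theorem Ek_pos {T : ℝ} (hT : 0 < T) (u θ : ℝ) : 0 < Ek T u θ := by
  unfold Ek; positivity

/-- `Q` in the form `(x - c)² + (1 - c²)` with `x = e^u`, `c = cos θ`. [folklore] -/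
theorem Qk_eq (u θ : ℝ) : Qk u θ = (Real.exp u - Real.cos θ) ^ 2 + (1 - Real.cos θ ^ 2) := by
  unfold Qk
  have : Real.exp (2 * u) = Real.exp u ^ 2 := by rw [sq, ← Real.exp_add]; ring_nf
  rw [this]; ring

/-- `0 ≤ Q`. [folklore] -/
theorem Qk_nonneg (u θ : ℝ) : 0 ≤ Qk u θ := by
  rw [Qk_eq]; nlinarith [Real.cos_sq_le_one θ, sq_nonneg (Real.exp u - Real.cos θ)]

/-! ### Upper bound (corner and box) -/

/-- A convex quadratic on an interval is below the larger end value: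
`x² + 1 - 2x cl ≤ max (xa² + 1 - 2 xa cl) (xb² + 1 - 2 xb cl)` for `x ∈ [xa, xb]`. [folklore] -/
theorem quad_le_max {x xa xb cl : ℝ} (h1 : xa ≤ x) (h2 : x ≤ xb) :
    x ^ 2 + 1 - 2 * x * cl ≤ max (xa ^ 2 + 1 - 2 * xa * cl) (xb ^ 2 + 1 - 2 * xb * cl) := by
  -- `(x - xa)(x - xb) ≤ 0` linearises `x²`
  have hlin : x ^ 2 ≤ (xa + xb) * x - xa * xb := by nlinarith
  have e1 : (xa + xb) * x - xa * xb + 1 - 2 * x * cl = (xa ^ 2 + 1 - 2 * xa * cl) + (xa + xb - 2 * cl) * (x - xa) := by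
    ring
  have e2 : (xa + xb) * x - xa * xb + 1 - 2 * x * cl = (xb ^ 2 + 1 - 2 * xb * cl) + (xa + xb - 2 * cl) * (x - xb) := by
    ring
  rcases le_total (xa + xb - 2 * cl) 0 with hs | hs
  · have hprod : (xa + xb - 2 * cl) * (x - xa) ≤ 0 := mul_nonpos_of_nonpos_of_nonneg hs (sub_nonneg.2 h1)
    refine le_trans ?_ (le_max_left _ _)
    linarith
  · have hprod : (xa + xb - 2 * cl) * (x - xb) ≤ 0 := mul_nonpos_of_nonneg_of_nonpos hs (sub_nonpos.2 h2)
    refine le_trans ?_ (le_max_right _ _)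
    linarith

/-- **Certified upper bound of the kernel** over `e^u ∈ [xlo, xhi]`, `cos θ ≤ chi` (`-1 ≤ chi ≤ 1`), uniformly in
`T ∈ [T₁, T₂]` (`0 < T₁`): with `Qlo = (clamp(chi; xlo, xhi) - chi)² + (1 - chi²)` and `Tc = clamp(Qlo/8; T₁, T₂)`,
`Ek ≤ rup (xhi⁴ · expHi(-Qlo/(4Tc)) / (6 Tc²))`. [folklore] -/
theorem Ek_upper {T1 T2 xlo xhi chi : ℚ} (p : ℕ) (hT1 : 0 < T1) {T u θ : ℝ} (hT : ((T1 : ℚ) : ℝ) ≤ T)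
    (hT' : T ≤ ((T2 : ℚ) : ℝ)) (hxlo : ((xlo : ℚ) : ℝ) ≤ Real.exp u) (hxhi : Real.exp u ≤ ((xhi : ℚ) : ℝ))
    (hc : Real.cos θ ≤ ((chi : ℚ) : ℝ)) (hchi1 : -1 ≤ chi) (hchi2 : chi ≤ 1) :
    Ek T u θ ≤ ((rup (xhi ^ 4 * expHi (-((clampQ chi xlo xhi - chi) ^ 2 + (1 - chi ^ 2)) /
      (4 * clampQ (((clampQ chi xlo xhi - chi) ^ 2 + (1 - chi ^ 2)) / 8) T1 T2)) p /
      (6 * clampQ (((clampQ chi xlo xhi - chi) ^ 2 + (1 - chi ^ 2)) / 8) T1 T2 ^ 2)) p : ℚ) : ℝ) := by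
  set r : ℚ := clampQ chi xlo xhi with hr
  set Qlo : ℚ := (r - chi) ^ 2 + (1 - chi ^ 2) with hQlo
  set Tc : ℚ := clampQ (Qlo / 8) T1 T2 with hTc
  have hT1r : (0 : ℝ) < (T1 : ℝ) := by exact_mod_cast hT1
  have hTpos : 0 < T := hT1r.trans_le hT
  -- `Qlo ≤ Q`
  have hQ : ((Qlo : ℚ) : ℝ) ≤ Qk u θ := by
    have h := Q_lower u (Real.cos θ) (chi : ℝ) (xlo : ℝ) (xhi : ℝ) hxlo hxhi hc
    unfold Qk
    have e : ((Qlo : ℚ) : ℝ) = (max (xlo : ℝ) (min (chi : ℝ) (xhi : ℝ)) - chi) ^ 2 + (1 - (chi : ℝ) ^ 2) := by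
      rw [hQlo, hr, clampQ]; push_cast; ring
    rw [e]; exact h
  have hQlo0 : (0 : ℝ) ≤ ((Qlo : ℚ) : ℝ) := by
    rw [hQlo]; push_cast
    have h1 : (chi : ℝ) ^ 2 ≤ 1 := by
      have ha : (-1 : ℝ) ≤ chi := by exact_mod_cast hchi1
      have hb : (chi : ℝ) ≤ 1 := by exact_mod_cast hchi2
      nlinarith
    nlinarith [sq_nonneg ((r : ℝ) - chi)]
  -- the `T`-envelope
  have henv := helper_certTsup (T1 : ℝ) (T2 : ℝ) T (Qk u θ) (Qlo : ℝ) hT1r hT hT' hQlo0 hQ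
  have hTc_eq : ((Tc : ℚ) : ℝ) = max (T1 : ℝ) (min ((Qlo : ℝ) / 8) (T2 : ℝ)) := by
    rw [hTc, clampQ]; push_cast; ring_nf
  have hTc_pos : 0 < Tc := lt_of_lt_of_le hT1 (le_max_left _ _)
  have hTc_posR : (0 : ℝ) < (Tc : ℝ) := by exact_mod_cast hTc_pos
  -- assemble
  refine le_trans ?_ (le_rup_real _ _)
  have hx0 : 0 ≤ Real.exp u := (Real.exp_pos u).le
  have hx4 : Real.exp (4 * u) ≤ ((xhi : ℚ) : ℝ) ^ 4 := by
    rw [show Real.exp (4 * u) = Real.exp u ^ 4 by rw [← Real.exp_nat_mul]; norm_num]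
    exact pow_le_pow_left₀ hx0 hxhi 4
  have hexpQ : (T ^ 2)⁻¹ * Real.exp (-Qk u θ / (4 * T)) ≤ ((Tc : ℚ) : ℝ)⁻¹ ^ 2 * ((expHi (-Qlo / (4 * Tc)) p : ℚ) : ℝ) := by
    refine henv.trans ?_
    rw [← hTc_eq]
    have h1 : Real.exp (-(Qlo : ℝ) / (4 * (Tc : ℝ))) ≤ ((expHi (-Qlo / (4 * Tc)) p : ℚ) : ℝ) := by
      have := exp_le_expHi (-Qlo / (4 * Tc)) p
      push_cast at this ⊢
      exact this
    rw [inv_pow]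
    exact mul_le_mul_of_nonneg_left h1 (by positivity)
  unfold Ek
  push_cast
  have h6 : (0 : ℝ) ≤ (6 : ℝ)⁻¹ := by norm_num
  calc (6 * T ^ 2)⁻¹ * Real.exp (4 * u) * Real.exp (-Qk u θ / (4 * T))
      = 6⁻¹ * Real.exp (4 * u) * ((T ^ 2)⁻¹ * Real.exp (-Qk u θ / (4 * T))) := by rw [mul_inv]; ring
    _ ≤ 6⁻¹ * ((xhi : ℝ) ^ 4) * (((Tc : ℚ) : ℝ)⁻¹ ^ 2 * ((expHi (-Qlo / (4 * Tc)) p : ℚ) : ℝ)) := by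
        gcongr
    _ = (xhi : ℝ) ^ 4 * ((expHi (-Qlo / (4 * Tc)) p : ℚ) : ℝ) / (6 * (Tc : ℝ) ^ 2) := by
        ring

/-! ### Lower bound on a box -/

/-- `φ(t) = t⁻² e^{-Q/(4t)}` on `[Ta, Tb]` (`0 < Ta`) is at least its smaller end value (it increases up to `Q/8` and
decreases afterwards). [folklore] -/
theorem phi_ge_min {Q Ta Tb T : ℝ} (hTa : 0 < Ta) (h1 : Ta ≤ T) (h2 : T ≤ Tb) :
    min ((Ta ^ 2)⁻¹ * Real.exp (-Q / (4 * Ta))) ((Tb ^ 2)⁻¹ * Real.exp (-Q / (4 * Tb))) ≤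
      (T ^ 2)⁻¹ * Real.exp (-Q / (4 * T)) := by
  have hT : 0 < T := hTa.trans_le h1
  have hTb : 0 < Tb := hT.trans_le h2
  rcases le_total (8 * T) Q with hle | hge
  · refine le_trans (min_le_left _ _) (Cert.Tsup_two_point Ta T Q hTa hT ?_)
    nlinarith
  · refine le_trans (min_le_right _ _) (Cert.Tsup_two_point Tb T Q hTb hT ?_)
    nlinarith

/-- **Certified lower bound of the kernel on a box**: `e^u ∈ [xa, xb]` (`0 ≤ xa`), `cl ≤ cos θ`, `T ∈ [Ta, Tb]` (`0 < Ta`):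
with `Qhi = max (xa² + 1 - 2 xa cl) (xb² + 1 - 2 xb cl)`,
`rdn (xa⁴ · min (expLo(-Qhi/(4Ta))/Ta²) (expLo(-Qhi/(4Tb))/Tb²) / 6) ≤ Ek`. [folklore] -/
theorem Ek_lower {xa xb cl Ta Tb : ℚ} (p : ℕ) (hxa : 0 ≤ xa) (hTa : 0 < Ta) {T u θ : ℝ} (hT : ((Ta : ℚ) : ℝ) ≤ T)
    (hT' : T ≤ ((Tb : ℚ) : ℝ)) (hx1 : ((xa : ℚ) : ℝ) ≤ Real.exp u) (hx2 : Real.exp u ≤ ((xb : ℚ) : ℝ))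
    (hc : ((cl : ℚ) : ℝ) ≤ Real.cos θ) :
    ((rdn (xa ^ 4 * min (expLo (-(max (xa ^ 2 + 1 - 2 * xa * cl) (xb ^ 2 + 1 - 2 * xb * cl)) / (4 * Ta)) p / Ta ^ 2)
      (expLo (-(max (xa ^ 2 + 1 - 2 * xa * cl) (xb ^ 2 + 1 - 2 * xb * cl)) / (4 * Tb)) p / Tb ^ 2) / 6) p : ℚ) : ℝ) ≤
      Ek T u θ := by
  set Qhi : ℚ := max (xa ^ 2 + 1 - 2 * xa * cl) (xb ^ 2 + 1 - 2 * xb * cl) with hQhi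
  have hTaR : (0 : ℝ) < (Ta : ℝ) := by exact_mod_cast hTa
  have hTpos : 0 < T := hTaR.trans_le hT
  have hTbR : (0 : ℝ) < (Tb : ℝ) := hTpos.trans_le hT'
  -- `Q ≤ Qhi`
  have hQ : Qk u θ ≤ ((Qhi : ℚ) : ℝ) := by
    have hx0 : 0 < Real.exp u := Real.exp_pos u
    have h1 : Qk u θ ≤ Real.exp u ^ 2 + 1 - 2 * Real.exp u * (cl : ℝ) := by
      unfold Qk
      have : Real.exp (2 * u) = Real.exp u ^ 2 := by rw [sq, ← Real.exp_add]; ring_nf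
      rw [this]; nlinarith [mul_le_mul_of_nonneg_left hc hx0.le]
    refine h1.trans ?_
    have h2 := quad_le_max (cl := ((cl : ℚ) : ℝ)) hx1 hx2
    rw [hQhi]; push_cast; exact h2
  refine (rdn_le_real _ _).trans ?_
  -- the real chain
  have hx4 : ((xa : ℚ) : ℝ) ^ 4 ≤ Real.exp (4 * u) := by
    rw [show Real.exp (4 * u) = Real.exp u ^ 4 by rw [← Real.exp_nat_mul]; norm_num]
    exact pow_le_pow_left₀ (by exact_mod_cast hxa) hx1 4
  have hφ := phi_ge_min (Q := ((Qhi : ℚ) : ℝ)) hTaR hT hT'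
  have hmin : ((min (expLo (-Qhi / (4 * Ta)) p / Ta ^ 2) (expLo (-Qhi / (4 * Tb)) p / Tb ^ 2) : ℚ) : ℝ) ≤
      min (((Ta : ℝ) ^ 2)⁻¹ * Real.exp (-(Qhi : ℝ) / (4 * (Ta : ℝ))))
        (((Tb : ℝ) ^ 2)⁻¹ * Real.exp (-(Qhi : ℝ) / (4 * (Tb : ℝ)))) := by
    push_cast
    refine min_le_min ?_ ?_
    · have := expLo_le (-Qhi / (4 * Ta)) p
      push_cast at this
      rw [div_eq_mul_inv, mul_comm]
      exact mul_le_mul_of_nonneg_left this (by positivity)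
    · have := expLo_le (-Qhi / (4 * Tb)) p
      push_cast at this
      rw [div_eq_mul_inv, mul_comm]
      exact mul_le_mul_of_nonneg_left this (by positivity)
  have hexpQ : (T ^ 2)⁻¹ * Real.exp (-(Qhi : ℝ) / (4 * T)) ≤ (T ^ 2)⁻¹ * Real.exp (-Qk u θ / (4 * T)) := by
    refine mul_le_mul_of_nonneg_left (Real.exp_le_exp.2 ?_) (by positivity)
    rw [neg_div, neg_div, neg_le_neg_iff]
    exact div_le_div_of_nonneg_right hQ (by positivity)
  unfold Ek
  push_cast
  calc (xa : ℝ) ^ 4 * min ((expLo (-Qhi / (4 * Ta)) p : ℝ) / (Ta : ℝ) ^ 2) ((expLo (-Qhi / (4 * Tb)) p : ℝ) / (Tb : ℝ) ^ 2) / 6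
      = 6⁻¹ * (xa : ℝ) ^ 4 * min ((expLo (-Qhi / (4 * Ta)) p : ℝ) / (Ta : ℝ) ^ 2) ((expLo (-Qhi / (4 * Tb)) p : ℝ) / (Tb : ℝ) ^ 2) := by
        ring
    _ ≤ 6⁻¹ * Real.exp (4 * u) * ((T ^ 2)⁻¹ * Real.exp (-Qk u θ / (4 * T))) := by
        have hm := (hmin.trans hφ).trans hexpQ
        push_cast at hm
        have e1 : (0 : ℝ) ≤ (expLo (-Qhi / (4 * Ta)) p : ℝ) := by exact_mod_cast expLo_nonneg _ _
        have e2 : (0 : ℝ) ≤ (expLo (-Qhi / (4 * Tb)) p : ℝ) := by exact_mod_cast expLo_nonneg _ _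
        have hmin0 : (0 : ℝ) ≤ min ((expLo (-Qhi / (4 * Ta)) p : ℝ) / (Ta : ℝ) ^ 2) ((expLo (-Qhi / (4 * Tb)) p : ℝ) / (Tb : ℝ) ^ 2) :=
          le_min (by positivity) (by positivity)
        rw [mul_assoc, mul_assoc]
        exact mul_le_mul_of_nonneg_left (mul_le_mul hx4 hm hmin0 (Real.exp_pos _).le) (by norm_num)
    _ = (6 * T ^ 2)⁻¹ * Real.exp (4 * u) * Real.exp (-Qk u θ / (4 * T)) := by rw [mul_inv]; ring

/-! ### Reduction of `T` to the envelope range -/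

/-- For `T ≤ T' ≤ Q/8` the kernel increases in `T`. [folklore] -/
theorem Ek_mono_T_of_le {T T' u θ : ℝ} (hT : 0 < T) (h1 : T ≤ T') (h2 : 8 * T' ≤ Qk u θ) : Ek T u θ ≤ Ek T' u θ := by
  have hT' : 0 < T' := hT.trans_le h1
  have h := Cert.Tsup_two_point T T' (Qk u θ) hT hT' (by nlinarith)
  unfold Ek
  calc (6 * T ^ 2)⁻¹ * Real.exp (4 * u) * Real.exp (-Qk u θ / (4 * T))
      = 6⁻¹ * Real.exp (4 * u) * ((T ^ 2)⁻¹ * Real.exp (-Qk u θ / (4 * T))) := by rw [mul_inv]; ring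
    _ ≤ 6⁻¹ * Real.exp (4 * u) * ((T' ^ 2)⁻¹ * Real.exp (-Qk u θ / (4 * T'))) :=
        mul_le_mul_of_nonneg_left h (by positivity)
    _ = (6 * T' ^ 2)⁻¹ * Real.exp (4 * u) * Real.exp (-Qk u θ / (4 * T')) := by rw [mul_inv]; ring

/-- For `Q/8 ≤ T' ≤ T` the kernel decreases in `T`. [folklore] -/
theorem Ek_mono_T_of_ge {T T' u θ : ℝ} (hT' : 0 < T') (h1 : T' ≤ T) (h2 : Qk u θ ≤ 8 * T') : Ek T u θ ≤ Ek T' u θ := by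
  have hT : 0 < T := hT'.trans_le h1
  have h := Cert.Tsup_two_point T T' (Qk u θ) hT hT' (by nlinarith)
  unfold Ek
  calc (6 * T ^ 2)⁻¹ * Real.exp (4 * u) * Real.exp (-Qk u θ / (4 * T))
      = 6⁻¹ * Real.exp (4 * u) * ((T ^ 2)⁻¹ * Real.exp (-Qk u θ / (4 * T))) := by rw [mul_inv]; ring
    _ ≤ 6⁻¹ * Real.exp (4 * u) * ((T' ^ 2)⁻¹ * Real.exp (-Qk u θ / (4 * T'))) :=
        mul_le_mul_of_nonneg_left h (by positivity)
    _ = (6 * T' ^ 2)⁻¹ * Real.exp (4 * u) * Real.exp (-Qk u θ / (4 * T')) := by rw [mul_inv]; ring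

/-! ### Partial derivatives -/

/-- `∂_u Ek = Ek · (4 - e^u (e^u - cos θ)/(2T))`. [folklore] -/
theorem hasDerivAt_Ek_u {T : ℝ} (hT : T ≠ 0) (u θ : ℝ) :
    HasDerivAt (fun v => Ek T v θ) (Ek T u θ * (4 - Real.exp u * (Real.exp u - Real.cos θ) / (2 * T))) u := by
  have h4 : HasDerivAt (fun v => Real.exp (4 * v)) (Real.exp (4 * u) * 4) u := by
    have := ((hasDerivAt_id u).const_mul (4 : ℝ)).exp
    simpa using this
  have h2 : HasDerivAt (fun v => Real.exp (2 * v)) (Real.exp (2 * u) * 2) u := by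
    have := ((hasDerivAt_id u).const_mul (2 : ℝ)).exp
    simpa using this
  have h1 : HasDerivAt (fun v => 2 * Real.exp v * Real.cos θ) (2 * Real.exp u * Real.cos θ) u := by
    have := ((Real.hasDerivAt_exp u).const_mul (2 : ℝ)).mul_const (Real.cos θ)
    simpa using this
  have hQ : HasDerivAt (fun v => Qk v θ) (Real.exp (2 * u) * 2 - 2 * Real.exp u * Real.cos θ) u := by
    have := (h2.sub h1).add_const 1
    exact this
  have hE : HasDerivAt (fun v => Real.exp (-Qk v θ / (4 * T)))
      (Real.exp (-Qk u θ / (4 * T)) * (-(Real.exp (2 * u) * 2 - 2 * Real.exp u * Real.cos θ) / (4 * T))) u :=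
    ((hQ.neg).div_const (4 * T)).exp
  have hprod : HasDerivAt (fun v => (6 * T ^ 2)⁻¹ * (Real.exp (4 * v) * Real.exp (-Qk v θ / (4 * T))))
      ((6 * T ^ 2)⁻¹ * (Real.exp (4 * u) * 4 * Real.exp (-Qk u θ / (4 * T)) +
        Real.exp (4 * u) * (Real.exp (-Qk u θ / (4 * T)) *
          (-(Real.exp (2 * u) * 2 - 2 * Real.exp u * Real.cos θ) / (4 * T))))) u :=
    (h4.mul hE).const_mul _
  have key : (fun v => Ek T v θ) = fun v => (6 * T ^ 2)⁻¹ * (Real.exp (4 * v) * Real.exp (-Qk v θ / (4 * T))) := by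
    funext v; unfold Ek; ring
  rw [key]
  refine hprod.congr_deriv ?_
  unfold Ek
  have : Real.exp (2 * u) = Real.exp u ^ 2 := by rw [sq, ← Real.exp_add]; ring_nf
  rw [this]
  field_simp
  ring

/-- `∂_θ Ek = -(Ek · e^u sin θ /(2T))`. [folklore] -/
theorem hasDerivAt_Ek_θ {T : ℝ} (hT : T ≠ 0) (u θ : ℝ) :
    HasDerivAt (fun η => Ek T u η) (-(Ek T u θ * Real.exp u * Real.sin θ / (2 * T))) θ := by
  have h1 : HasDerivAt (fun η => 2 * Real.exp u * Real.cos η) (2 * Real.exp u * -Real.sin θ) θ :=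
    (Real.hasDerivAt_cos θ).const_mul (2 * Real.exp u)
  have hQ : HasDerivAt (fun η => Qk u η) (0 - 2 * Real.exp u * -Real.sin θ) θ := by
    have := ((hasDerivAt_const θ (Real.exp (2 * u))).sub h1).add_const 1
    exact this
  have hE : HasDerivAt (fun η => Real.exp (-Qk u η / (4 * T)))
      (Real.exp (-Qk u θ / (4 * T)) * (-(0 - 2 * Real.exp u * -Real.sin θ) / (4 * T))) θ :=
    ((hQ.neg).div_const (4 * T)).exp
  have hprod : HasDerivAt (fun η => (6 * T ^ 2)⁻¹ * Real.exp (4 * u) * Real.exp (-Qk u η / (4 * T)))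
      ((6 * T ^ 2)⁻¹ * Real.exp (4 * u) *
        (Real.exp (-Qk u θ / (4 * T)) * (-(0 - 2 * Real.exp u * -Real.sin θ) / (4 * T)))) θ :=
    hE.const_mul _
  have key : (fun η => Ek T u η) = fun η => (6 * T ^ 2)⁻¹ * Real.exp (4 * u) * Real.exp (-Qk u η / (4 * T)) := by
    funext η; unfold Ek; ring
  rw [key]
  refine hprod.congr_deriv ?_
  unfold Ek
  field_simp
  ring

/-! ### Cosine, square root and sine enclosures -/

/-- **The fast validated square roots bracket `√x`**: `ksqrtLoF x p ≤ √x ≤ ksqrtHiF x p`. [folklore] -/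
theorem ksqrtF_spec (x : ℚ) (p : ℕ) :
    ((ksqrtLoF x p : ℚ) : ℝ) ≤ Real.sqrt (x : ℝ) ∧ Real.sqrt (x : ℝ) ≤ ((ksqrtHiF x p : ℚ) : ℝ) := by
  constructor
  · unfold ksqrtLoF
    dsimp only
    split_ifs with h
    · rcases le_or_gt 0 x with hx | hx
      · apply Real.le_sqrt_of_sq_le
        have h1 : (((isqrtF 200 ⌊x * 4 ^ p⌋₊ (2 ^ p) : ℕ) : ℝ)) ^ 2 ≤ ((⌊x * 4 ^ p⌋₊ : ℕ) : ℝ) := by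
          have : (isqrtF 200 ⌊x * 4 ^ p⌋₊ (2 ^ p)) ^ 2 ≤ ⌊x * 4 ^ p⌋₊ := by rw [sq]; exact h
          exact_mod_cast this
        have h2 : ((⌊x * 4 ^ p⌋₊ : ℕ) : ℚ) ≤ x * 4 ^ p := Nat.floor_le (by positivity)
        have h3 : (((⌊x * 4 ^ p⌋₊ : ℕ) : ℚ) : ℝ) ≤ ((x * 4 ^ p : ℚ) : ℝ) := Rat.cast_le.mpr h2
        push_cast at h3 ⊢
        have h4 : ((4 : ℝ) ^ p) = (2 ^ p) ^ 2 := by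
          rw [← pow_mul, mul_comm, pow_mul]; norm_num
        rw [div_pow, div_le_iff₀ (by positivity), ← h4]
        exact h1.trans h3
      · have h0 : ⌊x * 4 ^ p⌋₊ = 0 := Nat.floor_of_nonpos (mul_nonpos_of_nonpos_of_nonneg hx.le (by positivity))
        have hr : isqrtF 200 ⌊x * 4 ^ p⌋₊ (2 ^ p) = 0 := by
          have h' := h
          rw [h0] at h' ⊢
          exact Nat.eq_zero_of_le_zero (le_trans (Nat.le_mul_self _) h')
        rw [hr]
        simp [Real.sqrt_nonneg]
    · push_cast; exact Real.sqrt_nonneg _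
  · unfold ksqrtHiF
    dsimp only
    split_ifs with h
    · have hpos : (0 : ℝ) < 2 ^ p := by positivity
      rw [Real.sqrt_le_left (by positivity)]
      push_cast
      have h4 : ((4 : ℝ) ^ p) = (2 ^ p) ^ 2 := by
        rw [← pow_mul, mul_comm, pow_mul]; norm_num
      rw [div_pow, le_div_iff₀ (by positivity), ← h4]
      have h1 : ((⌊x * 4 ^ p⌋₊ : ℕ) : ℝ) + 1 ≤ (((isqrtF 200 ⌊x * 4 ^ p⌋₊ (2 ^ p) + 1 : ℕ) : ℝ)) ^ 2 := by
        have : ⌊x * 4 ^ p⌋₊ + 1 ≤ (isqrtF 200 ⌊x * 4 ^ p⌋₊ (2 ^ p) + 1) ^ 2 := by rw [sq]; exact h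
        exact_mod_cast this
      have h2 : (x : ℝ) * 4 ^ p < ((⌊x * 4 ^ p⌋₊ : ℕ) : ℝ) + 1 := by
        have := Nat.lt_floor_add_one (x * 4 ^ p)
        have h' : ((x * 4 ^ p : ℚ) : ℝ) < (((⌊x * 4 ^ p⌋₊ : ℕ) : ℚ) : ℝ) + 1 := by exact_mod_cast this
        push_cast at h'
        exact h'
      push_cast at h1 ⊢
      linarith
    · push_cast
      rcases le_total (x : ℝ) 1 with hx | hx
      · exact le_trans ((Real.sqrt_le_sqrt hx).trans_eq Real.sqrt_one) (le_max_left _ _)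
      · refine le_trans ?_ (le_max_right _ _)
        rw [Real.sqrt_le_left (by linarith)]
        nlinarith

/-- **Sine enclosure from a cosine enclosure** on `[0, π]`: if `cl ≤ cos θ ≤ ch` then
`ksqrtLoF (1 - max cl² ch²) ≤ sin θ ≤ ksqrtHiF (1 - cmin²)` with `cmin² = cl²` if `0 ≤ cl`, `ch²` if `ch ≤ 0`, else `0`.
[folklore] -/
theorem sin_memF {cl ch : ℚ} (p : ℕ) {θ : ℝ} (h0 : 0 ≤ θ) (hπ : θ ≤ Real.pi) (hcl : ((cl : ℚ) : ℝ) ≤ Real.cos θ)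
    (hch : Real.cos θ ≤ ((ch : ℚ) : ℝ)) :
    ((ksqrtLoF (1 - max (cl ^ 2) (ch ^ 2)) p : ℚ) : ℝ) ≤ Real.sin θ ∧
      Real.sin θ ≤ ((ksqrtHiF (1 - (if 0 ≤ cl then cl ^ 2 else if ch ≤ 0 then ch ^ 2 else 0)) p : ℚ) : ℝ) := by
  rw [Real.sin_eq_sqrt_one_sub_cos_sq h0 hπ]
  constructor
  · refine (ksqrtF_spec _ _).1.trans (Real.sqrt_le_sqrt ?_)
    push_cast
    have : Real.cos θ ^ 2 ≤ max ((cl : ℝ) ^ 2) ((ch : ℝ) ^ 2) := by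
      rcases le_total 0 (Real.cos θ) with hc | hc
      · exact le_trans (pow_le_pow_left₀ hc hch 2) (le_max_right _ _)
      · refine le_trans ?_ (le_max_left _ _)
        have : (-(Real.cos θ)) ^ 2 ≤ (-(cl : ℝ)) ^ 2 := pow_le_pow_left₀ (by linarith) (by linarith) 2
        simpa using this
    linarith
  · refine le_trans (Real.sqrt_le_sqrt ?_) (ksqrtF_spec _ _).2
    split_ifs with h1 h2 <;> push_cast
    · have h1' : (0 : ℝ) ≤ cl := by exact_mod_cast h1
      have : ((cl : ℝ)) ^ 2 ≤ Real.cos θ ^ 2 := pow_le_pow_left₀ h1' hcl 2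
      linarith
    · have h2' : ((ch : ℚ) : ℝ) ≤ 0 := by exact_mod_cast h2
      have : (-(ch : ℝ)) ^ 2 ≤ (-(Real.cos θ)) ^ 2 := pow_le_pow_left₀ (by linarith) (by linarith) 2
      have : ((ch : ℝ)) ^ 2 ≤ Real.cos θ ^ 2 := by simpa using this
      linarith
    · nlinarith [Real.cos_sq_le_one θ, sq_nonneg (Real.cos θ)]

end KCert


/-- Registered sub-goal marker `stub_certMid_part6` of crux stmt-SmoothPoincare4-7631 (helper file 6 of the kernel-clean
`stub_certMid`, line killing-flux): the pulled-back kernel is positive. [folklore] -/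
theorem stub_certMid_part6 : ∀ T u θ : ℝ, 0 < T → 0 < (6 * T ^ 2)⁻¹ * Real.exp (4 * u) * Real.exp (-(Real.exp (2 * u) - 2 * Real.exp u * Real.cos θ + 1) / (4 * T)) :=
  fun _ u θ hT => KCert.Ek_pos hT u θ

end Summit.SmoothPoincare4.SmoothPoincare4.Cruxes.CylinderRungTwo.KillingFlux

end
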